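import Summits.QuantumFields.YangMills.Theorems.LuscherReductionTwistedTraceScalingBOCentralQuasimodeRate
import Summits.QuantumFields.YangMills.Theorems.LuscherReductionTwistedTraceScalingBODefectRates
import HarnessLib

/-!
# (C4-CORE γ-rates, core piece) THE FULL CORE RATE `b_core² = (ε + κ_P)²·8/((1−κ_P)(1−η)²(1−κ_Q))` IS `o(λ_bare)` for `1/6 < s < 1/4`
# (lane A of S-BASE, crux `TwistedTraceScaling` stmt-QuantumFields-20203, C4-CORE, the (OD) pen; `pub/ym-fleet/ym-luscher-20007-p1/HANDOFF-g20.md` (γ))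

`…BOCentralQuasimodeRate.defectRate_hb_small` controls the quasimode part `ε(β)²` of the rate of `…BODefectCoreCurrency.core_defect_currency`; the full rate there is
`b_core = (ε + κ_P)·√(8/((1−κ_P)(1−η)²(1−κ_Q)))`, `κ_P = C_p(43β^{-s})²`, `κ_Q = C_q(43β^{-s})²`, `η = β^{-1/5}`.  ★ `powScale_le_bareLambda` — `β^{-p} = o(bareLambda(L³β))` for `p > 1/3`
(`bareLambda(B) = (2/B)^{1/3}`); hence `κ_P = O(β^{-2s}) = o(λ_bare)` for `s > 1/6`, and ★★ `core_rate_small` — `∀ a > 0, ∀ᶠ β, b_core(β)² ≤ a·bareLambda(L³β)`.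
HONEST FRAMING: bookkeeping for a stub of a child of the CONDITIONAL route R2b1; the hOD assembly, (B-ST), C4-CORE remain OPEN; not a gap, not Clay.
-/

set_option autoImplicit false

noncomputable section

open Filter Topology Real
open Literature.MathematicalPhysics.QuantumFieldTheory
open Literature.MathematicalPhysics.QuantumLattice

namespace Summit.QuantumFields.YangMills.Theorems.FemtoTransferGap.TwoLattice.ConstTube

open Summit.QuantumFields.YangMills.Theorems.FemtoTransferGap
open Summit.QuantumFields.YangMills.Theorems.FemtoTransferGap.TwoLattice

variable {L : ℕ} [NeZero L]

/-- ★ `β^{-p} = o(bareLambda(L³β))` for `p > 1/3`: `∀ a > 0, ∀ᶠ β, powScale p β ≤ a·bareLambda(L³β)`. [cite: Luscher1983, §1] -/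
theorem powScale_le_bareLambda {p : ℝ} (hp : 1 / 3 < p) : ∀ a : ℝ, 0 < a → ∀ᶠ β : ℝ in atTop, powScale p β ≤ a * bareLambda ((L : ℝ) ^ 3 * β) := by
  intro a ha
  have hL1 : (1 : ℝ) ≤ L := by exact_mod_cast NeZero.one_le
  have hL3 : (0 : ℝ) < (L : ℝ) ^ 3 := by positivity
  set c : ℝ := (2 / (L : ℝ) ^ 3) ^ ((1 : ℝ) / 3) with hc
  have hc0 : 0 < c := Real.rpow_pos_of_pos (by positivity) _
  have ht := tendsto_powScale (σ := p - 1 / 3) (by linarith)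
  filter_upwards [ht.eventually (eventually_le_nhds (show 0 < a * c by positivity)), eventually_ge_atTop (1 : ℝ)] with β hβ hβ1
  have hβ0 : 0 < β := by linarith
  -- `bareLambda(L³β) = c·β^{-1/3}` and `powScale p β = powScale (p − 1/3) β · powScale (1/3) β`
  have hlam : bareLambda ((L : ℝ) ^ 3 * β) = c * powScale (1 / 3) β := by
    unfold bareLambda
    rw [hc, powScale_eq hβ1, show (2 : ℝ) / ((L : ℝ) ^ 3 * β) = 2 / (L : ℝ) ^ 3 * β⁻¹ by field_simp,
      Real.mul_rpow (by positivity) (inv_nonneg.2 hβ0.le), Real.inv_rpow hβ0.le, Real.rpow_neg hβ0.le]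
  have hsplit : powScale p β = powScale (p - 1 / 3) β * powScale (1 / 3) β := by rw [powScale_mul_powScale]; ring_nf
  rw [hlam, hsplit, ← mul_assoc]
  exact mul_le_mul_of_nonneg_right hβ (powScale_pos _ _).le

set_option maxHeartbeats 800000 in
-- explicit record expressions.
/-- ★★ **THE FULL CORE RATE IS `o(λ_bare)`** for `1/6 < s < 1/4`, `D ≥ 0`, `C_p, C_q ≥ 0` (see the module docstring). [cite: Luscher1983, §3] -/
theorem core_rate_small {s D Cp Cq : ℝ} (hs : 1 / 6 < s) (hs4 : s < 1 / 4) (hD : 0 ≤ D) (hCp : 0 ≤ Cp) (hCq : 0 ≤ Cq) :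
    ∀ a : ℝ, 0 < a → ∀ᶠ β : ℝ in atTop, ((max (1 - Real.exp (-(coreEta L β (D * powScale s β) ((D * powScale s β) + (14 * powScale s β)) (9 * (L : ℝ) * (5 * (powScale (1 / 2) β * btLog β ^ 2)) + (powScale 1 β)) (min (1 / 40) (powScale (1 / 2) β * btLog β)) ((powScale 1 β) * Fintype.card (Site 3 L)) (powScale (2 * s) β) + coreEps1 L β (D * powScale s β) (9 * (L : ℝ) * (5 * (powScale (1 / 2) β * btLog β ^ 2)) + (powScale 1 β)) (min (1 / 40) (powScale (1 / 2) β * btLog β)) + coreEps2 L β (D * powScale s β) (9 * (L : ℝ) * (5 * (powScale (1 / 2) β * btLog β ^ 2)) + (powScale 1 β)) (min (1 / 40) (powScale (1 / 2) β * btLog β)) (powScale (2 * s) β))) * (1 - powScale (1 / 5) β)) (Real.exp (coreEta L β (D * powScale s β) ((D * powScale s β) + (14 * powScale s β)) (9 * (L : ℝ) * (5 * (powScale (1 / 2) β * btLog β ^ 2)) + (powScale 1 β)) (min (1 / 40) (powScale (1 / 2) β * btLog β)) ((powScale 1 β) * Fintype.card (Site 3 L)) (powScale (2 * s) β) + coreEps1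 L β (D * powScale s β) (9 * (L : ℝ) * (5 * (powScale (1 / 2) β * btLog β ^ 2)) + (powScale 1 β)) (min (1 / 40) (powScale (1 / 2) β * btLog β)) + coreEps2 L β (D * powScale s β) (9 * (L : ℝ) * (5 * (powScale (1 / 2) β * btLog β ^ 2)) + (powScale 1 β)) (min (1 / 40) (powScale (1 / 2) β * btLog β)) (powScale (2 * s) β)) * (1 + powScale (1 / 5) β) - 1) + (Cp * (43 * powScale s β) ^ 2)) * Real.sqrt (8 / ((1 - (Cp * (43 * powScale s β) ^ 2)) * (1 - powScale (1 / 5) β) ^ 2 * (1 - (Cq * (43 * powScale s β) ^ 2))))) ^ 2 ≤ a * bareLambda ((L : ℝ) ^ 3 * β) := by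
  intro a ha
  have hs0 : 0 < s := by linarith
  have hε := defectRate_hb_small (L := L) (D := D) hs hs4 hD (a / 512) (by positivity)
  -- `κ_P = C_p·43²·β^{-2s} ≤ (a/512)·λ` (as `2s > 1/3`) and `κ_P, κ_Q, η ≤ 1/2`
  have hκt : Tendsto (fun β : ℝ => (43 * powScale s β) ^ 2) atTop (𝓝 0) := by
    have h := ((tendsto_powScale hs0).const_mul 43).pow 2
    rw [mul_zero, zero_pow two_ne_zero] at h; exact h
  have hκP : ∀ᶠ β : ℝ in atTop, (Cp * (43 * powScale s β) ^ 2) ≤ 1 / 2 := by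
    have h := hκt.const_mul Cp; rw [mul_zero] at h; exact h.eventually (eventually_le_nhds (by norm_num))
  have hκQ : ∀ᶠ β : ℝ in atTop, (Cq * (43 * powScale s β) ^ 2) ≤ 1 / 2 := by
    have h := hκt.const_mul Cq; rw [mul_zero] at h; exact h.eventually (eventually_le_nhds (by norm_num))
  have hη : ∀ᶠ β : ℝ in atTop, powScale (1 / 5) β ≤ 1 / 2 := (tendsto_powScale (σ := 1 / 5) (by norm_num)).eventually (eventually_le_nhds (by norm_num))
  have hκlam : ∀ᶠ β : ℝ in atTop, (Cp * (43 * powScale s β) ^ 2) ≤ a / 512 * bareLambda ((L : ℝ) ^ 3 * β) := by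
    have h := powScale_le_bareLambda (L := L) (p := 2 * s) (by linarith) (a / 512 / (Cp * 43 ^ 2 + 1)) (by positivity)
    have hL1 : (1 : ℝ) ≤ L := by exact_mod_cast NeZero.one_le
    filter_upwards [h, eventually_ge_atTop (2 : ℝ)] with β hβ hβ2
    have e : (Cp * (43 * powScale s β) ^ 2) = Cp * 43 ^ 2 * powScale (2 * s) β := by
      rw [mul_pow, show powScale s β ^ 2 = powScale (2 * s) β by rw [pow_two, powScale_mul_powScale]; ring_nf]; ring
    rw [e]
    have hB2 : 2 ≤ (L : ℝ) ^ 3 * β := by nlinarith [one_le_pow₀ (M₀ := ℝ) hL1 (n := 3)]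
    have hl0 : 0 ≤ bareLambda ((L : ℝ) ^ 3 * β) := (bareLambda_pos_le_one hB2).1.le
    calc Cp * 43 ^ 2 * powScale (2 * s) β ≤ (Cp * 43 ^ 2 + 1) * (a / 512 / (Cp * 43 ^ 2 + 1) * bareLambda ((L : ℝ) ^ 3 * β)) :=
          mul_le_mul (by linarith) hβ (powScale_pos _ _).le (by positivity)
      _ = a / 512 * bareLambda ((L : ℝ) ^ 3 * β) := by field_simp
  filter_upwards [hε, hκP, hκQ, hη, hκlam, eventually_ge_atTop (2 : ℝ)] with β hεβ hκPβ hκQβ hηβ hκlamβ hβ2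
  have hL1 : (1 : ℝ) ≤ L := by exact_mod_cast NeZero.one_le
  have hB2 : 2 ≤ (L : ℝ) ^ 3 * β := by nlinarith [one_le_pow₀ (M₀ := ℝ) hL1 (n := 3)]
  have hlam0 : 0 < bareLambda ((L : ℝ) ^ 3 * β) := (bareLambda_pos_le_one hB2).1
  have hκP0 : 0 ≤ (Cp * (43 * powScale s β) ^ 2) := by positivity
  have hκQ0 : 0 ≤ (Cq * (43 * powScale s β) ^ 2) := by positivity
  have hη0 : 0 ≤ powScale (1 / 5) β := (powScale_pos _ _).le
  -- the square root factor: `8/((1−κP)(1−η)²(1−κQ)) ≤ 128`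
  have hden : (1 : ℝ) / 16 ≤ (1 - (Cp * (43 * powScale s β) ^ 2)) * (1 - powScale (1 / 5) β) ^ 2 * (1 - (Cq * (43 * powScale s β) ^ 2)) := by
    have h1 : (1 : ℝ) / 2 ≤ 1 - (Cp * (43 * powScale s β) ^ 2) := by linarith
    have h2 : (1 : ℝ) / 4 ≤ (1 - powScale (1 / 5) β) ^ 2 := by nlinarith
    have h3 : (1 : ℝ) / 2 ≤ 1 - (Cq * (43 * powScale s β) ^ 2) := by linarith
    calc (1 : ℝ) / 16 = 1 / 2 * (1 / 4) * (1 / 2) := by norm_num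
      _ ≤ _ := mul_le_mul (mul_le_mul h1 h2 (by norm_num) (by linarith)) h3 (by norm_num) (by positivity)
  have hsq : Real.sqrt (8 / ((1 - (Cp * (43 * powScale s β) ^ 2)) * (1 - powScale (1 / 5) β) ^ 2 * (1 - (Cq * (43 * powScale s β) ^ 2)))) ^ 2 ≤ 128 := by
    rw [Real.sq_sqrt (by positivity)]
    rw [div_le_iff₀ (by positivity)]; linarith
  -- `(ε + κP)² ≤ 2ε² + 2κP²`, `κP² ≤ κP`
  have hκP2 : (Cp * (43 * powScale s β) ^ 2) ^ 2 ≤ (Cp * (43 * powScale s β) ^ 2) := by nlinarith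
  set ε : ℝ := (max (1 - Real.exp (-(coreEta L β (D * powScale s β) ((D * powScale s β) + (14 * powScale s β)) (9 * (L : ℝ) * (5 * (powScale (1 / 2) β * btLog β ^ 2)) + (powScale 1 β)) (min (1 / 40) (powScale (1 / 2) β * btLog β)) ((powScale 1 β) * Fintype.card (Site 3 L)) (powScale (2 * s) β) + coreEps1 L β (D * powScale s β) (9 * (L : ℝ) * (5 * (powScale (1 / 2) β * btLog β ^ 2)) + (powScale 1 β)) (min (1 / 40) (powScale (1 / 2) β * btLog β)) + coreEps2 L β (D * powScale s β) (9 * (L : ℝ) * (5 * (powScale (1 / 2) β * btLog β ^ 2)) + (powScale 1 β)) (min (1 / 40) (powScale (1 / 2) β * btLog β)) (powScale (2 * s) β))) * (1 - powScale (1 / 5) β)) (Real.exp (coreEta L β (D * powScale s β) ((D * powScale s β) + (14 * powScale s β)) (9 * (L : ℝ) * (5 * (powScale (1 / 2) β * btLog β ^ 2)) + (powScale 1 β)) (min (1 / 40) (powScale (1 / 2) β * btLog β)) ((powScale 1 β) * Fintype.card (Site 3 L)) (powScale (2 * s) β) + coreEps1 L β (D * powScale s β) (9 * (L : ℝ) *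 (5 * (powScale (1 / 2) β * btLog β ^ 2)) + (powScale 1 β)) (min (1 / 40) (powScale (1 / 2) β * btLog β)) + coreEps2 L β (D * powScale s β) (9 * (L : ℝ) * (5 * (powScale (1 / 2) β * btLog β ^ 2)) + (powScale 1 β)) (min (1 / 40) (powScale (1 / 2) β * btLog β)) (powScale (2 * s) β)) * (1 + powScale (1 / 5) β) - 1)) with hεdef
  have hsum : (ε + (Cp * (43 * powScale s β) ^ 2)) ^ 2 ≤ 2 * ε ^ 2 + 2 * (Cp * (43 * powScale s β) ^ 2) := by nlinarith [sq_nonneg (ε - (Cp * (43 * powScale s β) ^ 2))]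
  have hmain : ((max (1 - Real.exp (-(coreEta L β (D * powScale s β) ((D * powScale s β) + (14 * powScale s β)) (9 * (L : ℝ) * (5 * (powScale (1 / 2) β * btLog β ^ 2)) + (powScale 1 β)) (min (1 / 40) (powScale (1 / 2) β * btLog β)) ((powScale 1 β) * Fintype.card (Site 3 L)) (powScale (2 * s) β) + coreEps1 L β (D * powScale s β) (9 * (L : ℝ) * (5 * (powScale (1 / 2) β * btLog β ^ 2)) + (powScale 1 β)) (min (1 / 40) (powScale (1 / 2) β * btLog β)) + coreEps2 L β (D * powScale s β) (9 * (L : ℝ) * (5 * (powScale (1 / 2) β * btLog β ^ 2)) + (powScale 1 β)) (min (1 / 40) (powScale (1 / 2) β * btLog β)) (powScale (2 * s) β))) * (1 - powScale (1 / 5) β)) (Real.exp (coreEta L β (D * powScale s β) ((D * powScale s β) + (14 * powScale s β)) (9 * (L : ℝ) * (5 * (powScale (1 / 2) β * btLog β ^ 2)) + (powScale 1 β)) (min (1 / 40) (powScale (1 / 2) β * btLog β)) ((powScale 1 β) * Fintype.card (Site 3 L)) (powScale (2 * s) β) + coreEps1 L β (D * powScale s β) (9 * (L : ℝ) * (5 *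 (powScale (1 / 2) β * btLog β ^ 2)) + (powScale 1 β)) (min (1 / 40) (powScale (1 / 2) β * btLog β)) + coreEps2 L β (D * powScale s β) (9 * (L : ℝ) * (5 * (powScale (1 / 2) β * btLog β ^ 2)) + (powScale 1 β)) (min (1 / 40) (powScale (1 / 2) β * btLog β)) (powScale (2 * s) β)) * (1 + powScale (1 / 5) β) - 1) + (Cp * (43 * powScale s β) ^ 2)) * Real.sqrt (8 / ((1 - (Cp * (43 * powScale s β) ^ 2)) * (1 - powScale (1 / 5) β) ^ 2 * (1 - (Cq * (43 * powScale s β) ^ 2))))) ^ 2 = (ε + (Cp * (43 * powScale s β) ^ 2)) ^ 2 * Real.sqrt (8 / ((1 - (Cp * (43 * powScale s β) ^ 2)) * (1 - powScale (1 / 5) β) ^ 2 * (1 - (Cq * (43 * powScale s β) ^ 2)))) ^ 2 := by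
    rw [hεdef]; ring
  rw [hmain]
  calc (ε + (Cp * (43 * powScale s β) ^ 2)) ^ 2 * Real.sqrt (8 / ((1 - (Cp * (43 * powScale s β) ^ 2)) * (1 - powScale (1 / 5) β) ^ 2 * (1 - (Cq * (43 * powScale s β) ^ 2)))) ^ 2
      ≤ (2 * ε ^ 2 + 2 * (Cp * (43 * powScale s β) ^ 2)) * 128 := mul_le_mul hsum hsq (sq_nonneg _) (by positivity)
    _ ≤ (2 * (a / 512 * bareLambda ((L : ℝ) ^ 3 * β)) + 2 * (a / 512 * bareLambda ((L : ℝ) ^ 3 * β))) * 128 := by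
        gcongr
    _ = a * bareLambda ((L : ℝ) ^ 3 * β) := by ring

end Summit.QuantumFields.YangMills.Theorems.FemtoTransferGap.TwoLattice.ConstTube

end
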